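import Summits.AtomisticToContinuum.Crystallization.Theorems.FrustratedLawDichotomyStrainedPatchHomValueT2SlopeSoundA

/-!
# (I1) slope part D — ★★ THE PER-LABEL FIRST-ORDER FORCE HULL along the joint segment (`…HomValueT2Track` §14b, the junction-class bound `hp`;
# critic row 1674 (B) (I1) docket item 3 `slopeT2_sound`, fourth instalment; 27623 `(H) HomFloor`, hcp half; decomp-a2c hand-1 g49)

One label with argument path `q + tΔξ` under the frame path `V + tΔU` (`ΔU` symmetric; `δ = dispN ΔU Δξ` vanishing from `top` on), recorded on the
full box (`Rb`: entries/components along the whole segment), centre radius off the junction radii.  Then each component of the label's `y`-space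
force `β(ρ) y_a` changes along the segment by at most `Σ_{k<top} |dF Rb a k|↑/SC · |δ_k|` — the mean-value hull, valid for EVERY label (first order,
derivative off the finitely many junction parameters: part A `hasDerivAt_force_label` + `abs_sub_le_of_deriv_off`).
No definitions; 0 sorry; standard axioms.  `--supports stmt-AtomisticToContinuum-27623`.
-/

noncomputable section

namespace Summit.AtomisticToContinuum.Crystallization.Theorems.FrustratedLawDichotomyStrainedPatchHomValueT2Kit

open scoped BigOperators RealInnerProductSpace
open Finset
open Literature.Analysis.ValidatedNumerics.Numerics
open Summit.AtomisticToContinuum.Crystallization.Theorems.ChargedEnergyGapNegative (E3)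
open Summit.AtomisticToContinuum.Crystallization.Theorems.FrustratedLawDichotomySchurCut (effPot w₄₅ ω₄)
open Summit.AtomisticToContinuum.Crystallization.Theorems.FrustratedLawDichotomyStrainedPatchTaylorLeaves (junctions)
open Summit.AtomisticToContinuum.Crystallization.Theorems.FrustratedLawDichotomyStrainedPatchHomEntryGramHcp (dot3 mem_dot3)
open Summit.AtomisticToContinuum.Crystallization.Theorems.FrustratedLawDichotomyStrainedPatchTaylorRegular (continuousOn_deriv_Wrec)
open Summit.AtomisticToContinuum.Crystallization.Theorems.FrustratedLawDichotomyStrainedPatchHomCurvCoeff3 (abs_le_of_mem)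

/-- ★★ **PER-LABEL FIRST-ORDER FORCE HULL ALONG THE JOINT SEGMENT.** [folklore chaining: part A + `…SoundM.mem_coefL` + `…SoundP.finite_label_junctions`] -/
theorem force_label_hull (V ΔU : E3 →L[ℝ] E3) (q Δξ : E3) (hsym : ∀ a b : Fin 3, ent ΔU a b = ent ΔU b a) {top : ℕ} (htop : top ≤ 9)
    (hδ : ∀ k, top ≤ k → k < 9 → dispN ΔU Δξ k = 0) {EF : Fin 3 × Fin 3 → FI} {qF : Fin 3 → FI} {Rb : DRec} (hRb : mkDRec top EF qF = some Rb)
    (hEF : ∀ t ∈ Set.Icc (0 : ℝ) 1, ∀ ab : Fin 3 × Fin 3, FI.mem (((V + t • ΔU) (EuclideanSpace.single ab.2 (1 : ℝ))) ab.1) (EF ab))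
    (hqF : ∀ t ∈ Set.Icc (0 : ℝ) 1, ∀ c, FI.mem ((q + t • Δξ) c) (qF c)) (hJ0 : ‖V q‖ ∉ junctions) (a : Fin 3) :
    |deriv (effPot w₄₅ ω₄ (3 / 400)) ‖(V + ΔU) (q + Δξ)‖ / ‖(V + ΔU) (q + Δξ)‖ * ((V + ΔU) (q + Δξ)) a - deriv (effPot w₄₅ ω₄ (3 / 400)) ‖V q‖ / ‖V q‖ * (V q) a| ≤
      ∑ k ∈ range top, (((dF Rb a k).absHi : ℤ) : ℝ) / SC * |dispN ΔU Δξ k| := by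
  have hS := SC_pos
  have hpos : ∀ t ∈ Set.Icc (0 : ℝ) 1, 0 < ‖(V + t • ΔU) (q + t • Δξ)‖ := fun t ht => norm_pos_of_mkDRec hRb _ _ (hEF t ht) (hqF t ht)
  have hcoF := mkDRec_coefL hRb
  have hQF : ∀ t ∈ Set.Icc (0 : ℝ) 1, FI.mem (‖(V + t • ΔU) (q + t • Δξ)‖ ^ 2) (dot3 (tab3 (yOf EF (tab3 qF))) (tab3 (yOf EF (tab3 qF)))) :=
    fun t ht => mem_labelQ _ _ (hEF t ht) (hqF t ht)
  -- the path at `0` and `1`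
  have e0V : V + (0 : ℝ) • ΔU = V := by ext x; simp
  have e0q : q + (0 : ℝ) • Δξ = q := by rw [zero_smul, add_zero]
  have e1V : V + (1 : ℝ) • ΔU = V + ΔU := by ext x; simp
  have e1q : q + (1 : ℝ) • Δξ = q + Δξ := by rw [one_smul]
  have hyc : Continuous fun t : ℝ => (V + t • ΔU) (q + t • Δξ) :=
    continuous_iff_continuousAt.2 fun t => (hasDerivAt_labelPath V ΔU q Δξ t).continuousAt
  -- (1) continuity of the force component on `[0,1]`
  have hgc : ContinuousOn (fun t : ℝ => deriv (effPot w₄₅ ω₄ (3 / 400)) ‖(V + t • ΔU) (q + t • Δξ)‖ / ‖(V + t • ΔU) (q + t • Δξ)‖ * ((V + t • ΔU) (q + t • Δξ)) a) (Set.Icc 0 1) := by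
    intro t ht
    have hρc : ContinuousAt (fun t : ℝ => ‖(V + t • ΔU) (q + t • Δξ)‖) t := (hyc.norm).continuousAt
    have hW' : ContinuousAt (fun t : ℝ => deriv (effPot w₄₅ ω₄ (3 / 400)) ‖(V + t • ΔU) (q + t • Δξ)‖) t :=
      ContinuousAt.comp (g := deriv (effPot w₄₅ ω₄ (3 / 400))) (continuousOn_deriv_Wrec.continuousAt (Ioi_mem_nhds (hpos t ht))) hρc
    exact ((hW'.div hρc (hpos t ht).ne').mul (hasDerivAt_apply_path V ΔU q Δξ a t).continuousAt).continuousWithinAt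
  -- (2) the exceptional parameters
  classical
  set X : Finset ℝ := (finite_label_junctions V ΔU q Δξ hJ0).toFinset with hX
  have hXJ : ∀ t, t ∉ X → ‖(V + t • ΔU) (q + t • Δξ)‖ ∉ junctions := fun t ht hmem =>
    ht (by rw [hX, Set.Finite.mem_toFinset]; exact hmem)
  -- (3) the derivative off `X`
  have hg : ∀ t ∈ Set.Ioo (0 : ℝ) 1, t ∉ X → HasDerivAt (fun t : ℝ => deriv (effPot w₄₅ ω₄ (3 / 400)) ‖(V + t • ΔU) (q + t • Δξ)‖ / ‖(V + t • ΔU) (q + t • Δξ)‖ * ((V + t • ΔU) (q + t • Δξ)) a)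
      (∑ k ∈ range 9, ((deriv (deriv (effPot w₄₅ ω₄ (3 / 400))) ‖(V + t • ΔU) (q + t • Δξ)‖ - deriv (effPot w₄₅ ω₄ (3 / 400)) ‖(V + t • ΔU) (q + t • Δξ)‖ / ‖(V + t • ΔU) (q + t • Δξ)‖) / ‖(V + t • ΔU) (q + t • Δξ)‖ ^ 2 * (zetaN (V + t • ΔU) (q + t • Δξ) k * ((V + t • ΔU) (q + t • Δξ)) a) + deriv (effPot w₄₅ ω₄ (3 / 400)) ‖(V + t • ΔU) (q + t • Δξ)‖ / ‖(V + t • ΔU) (q + t • Δξ)‖ * dyR (V + t • ΔU) (q + t • Δξ) k a) * dispN ΔU Δξ k) t :=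
    fun t ht htX => hasDerivAt_force_label V ΔU q Δξ hsym (hpos t (Set.Ioo_subset_Icc_self ht)) (hXJ t htX) a
  -- (4) the derivative bound off `X`: entries in the box table
  have hM : ∀ t ∈ Set.Ioo (0 : ℝ) 1, t ∉ X → |∑ k ∈ range 9, ((deriv (deriv (effPot w₄₅ ω₄ (3 / 400))) ‖(V + t • ΔU) (q + t • Δξ)‖ - deriv (effPot w₄₅ ω₄ (3 / 400)) ‖(V + t • ΔU) (q + t • Δξ)‖ / ‖(V + t • ΔU) (q + t • Δξ)‖) / ‖(V + t • ΔU) (q + t • Δξ)‖ ^ 2 * (zetaN (V + t • ΔU) (q + t • Δξ) k * ((V + t • ΔU) (q + t • Δξ)) a) + deriv (effPot w₄₅ ω₄ (3 / 400)) ‖(V + t • ΔU) (q + t • Δξ)‖ / ‖(V + t • ΔU) (q + t • Δξ)‖ * dyR (V + t • ΔU) (q + t • Δξ) k a) * dispN ΔU Δξ k| ≤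
      ∑ k ∈ range top, (((dF Rb a k).absHi : ℤ) : ℝ) / SC * |dispN ΔU Δξ k| := by
    intro t ht htX
    have ht' := Set.Ioo_subset_Icc_self ht
    obtain ⟨mal, mbe⟩ := mem_coefL (hpos t ht') (hXJ t htX) (hQF t ht') hcoF
    rw [sum_range9_eq_sum_range htop hδ]
    refine (Finset.abs_sum_le_sum_abs _ _).trans (Finset.sum_le_sum fun k hk => ?_)
    rw [abs_mul]
    exact mul_le_mul_of_nonneg_right
      (abs_le_of_mem (mem_dF htop hRb (V + t • ΔU) (q + t • Δξ) (hEF t ht') (hqF t ht') mal mbe a (Finset.mem_range.1 hk))) (abs_nonneg _)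
  have h := abs_sub_le_of_deriv_off X hgc hg hM
  rw [e0V, e0q, e1V, e1q] at h
  exact h

end Summit.AtomisticToContinuum.Crystallization.Theorems.FrustratedLawDichotomyStrainedPatchHomValueT2Kit
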